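import Literature.Probability.LatticeModels.MeanFieldBoundGHS
import Literature.Probability.LatticeModels.FieldCurrentsTheta
import HarnessLib

/-!
# Second-order expansion of the magnetisation in scaled pair couplings, and the weak GHS inequality

Topic `Probability/LatticeModels`, namespace `Literature.Probability.LatticeModels`. Sequel of
`LebowitzInequality` (the coupling path `cplAt K B t`, `hasDerivAt_gksExpect_cplAt_cov`),
`MeanFieldBoundGHS` (one-body paths, `antitoneOn_gksTrunc_cplAt`, spin-flip symmetry),
`GHSInequality` (`gksExpect_ghs`) and `FieldCurrentsTheta` (the `θ`-system `thetaCorr`).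

This file supplies the "fundamental theorem of calculus" steps (5.38)–(5.43) of the proof of
Aizenman–Fernández 1986, Thm. 5.7, in the following form. Along the path `t ↦ K_t` that
multiplies the couplings of a set `B` of pair terms by `t`,

  `f(t) = ∑_{y ∈ Y} ⟨σ_y⟩_t`,  `f'(t) = ∑_{i ∈ B} Kᵢ ∑_y ⟨σ_y; σ_{bᵢ}⟩_t`,
  `f''(t) = ∑_{i,j ∈ B} Kᵢ Kⱼ ∑_y κ₃^t(σ_y; σ_{bᵢ}; σ_{bⱼ})`

(`σ_{bᵢ}` the bond spin of the term `i`, `κ₃` the third cumulant, (5.40)); the diagonal terms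
`κ₃(σ_y;σ_b;σ_b) = -2⟨σ_b⟩⟨σ_y;σ_b⟩` are `≤ 0` ((5.5)), and if the off-diagonal ones are bounded,
`∑_y κ₃^t(σ_y;σ_{bᵢ};σ_{bⱼ}) ≤ Ξᵢⱼ` on `[1-p, 1]`, then the elementary Taylor estimate
`f(1) - f(1-p) ≥ p f'(1) - (p²/2) sup f''` gives

  `∑_y (⟨σ_y⟩_K - ⟨σ_y⟩_{K_{1-p}}) ≥ p ∑_{i∈B} Kᵢ ∑_y ⟨σ_y;σ_{bᵢ}⟩_K - (p²/2) ∑_{i≠j} KᵢKⱼ Ξᵢⱼ`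
  (`gks_scaling_taylor`).

Aizenman–Fernández dilute a random subset of the bonds of density `p` instead of scaling all of
them by `1-p` ((5.37), (5.46)); the two procedures produce the same first- and second-order
structure (`p`, resp. `p²` off the diagonal), and scaling avoids the averaging over subsets.

The second result is the **weak GHS inequality** `∑_z h_z ⟨σ_a; σ_z⟩ ≤ ⟨σ_a⟩` for nonnegative
pair couplings and fields `h_z ≥ 0` (concavity of the magnetisation along `t ↦ t·h` and
`⟨σ_a⟩ = 0` at zero field; the finite-volume form of `χ ≤ M/h`, Aizenman–Fernández 1986, (4.26)
right / Lebowitz 1974), `gks_sum_field_cov_le`, and its `θ`-system form `thetaCorr_sum_trunc_le`.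

## References

* M. Aizenman, R. Fernández, J. Stat. Phys. **44** (1986) 393–454, §5.1 (5.5), §5.2
  (5.37)–(5.43), (5.46), pp. 426, 437–438 [AizenmanFernandezJSP1986].
* J. L. Lebowitz, Comm. Math. Phys. **35** (1974) 87–92, eq. (1.8), §2 Remark (ii) [Lebowitz1974].
* J. Glimm, A. Jaffe, *Quantum Physics*, 2nd ed., Springer 1987, §4.2, Prop. 4.2.1
  [GlimmJaffe1987].

## Mathlib

`antitoneOn_of_deriv_nonpos`, `monotoneOn_of_deriv_nonneg`, `interior_Icc`, `HasDerivAt.mul`,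
`HasDerivAt.sum`.
-/

noncomputable section

open Finset Set
open scoped symmDiff

namespace Literature.Probability.LatticeModels

/-! ## Part A. The elementary Taylor estimate -/

/-- **Taylor's estimate with a one-sided bound on the second derivative**: if `f' = g`, `g' ≤ U`
on `[1-p, 1]` (`0 ≤ p ≤ 1`), then `f(1) - f(1-p) ≥ p g(1) - U p²/2`. [folklore] -/
theorem sub_ge_of_deriv2_le {f g g' : ℝ → ℝ} {U p : ℝ} (hp0 : 0 ≤ p)
    (hf : ∀ t ∈ Icc (1 - p) 1, HasDerivAt f (g t) t) (hg : ∀ t ∈ Icc (1 - p) 1, HasDerivAt g (g' t) t)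
    (hU : ∀ t ∈ Icc (1 - p) 1, g' t ≤ U) : p * g 1 - U * p ^ 2 / 2 ≤ f 1 - f (1 - p) := by
  -- Step 1: `g t ≥ g 1 - U (1 - t)` on `[1-p, 1]`
  have hφ : AntitoneOn (fun t => g t + U * (1 - t)) (Icc (1 - p) 1) := by
    have hd : ∀ t ∈ Icc (1 - p) 1, HasDerivAt (fun t => g t + U * (1 - t)) (g' t - U) t := by
      intro t ht
      have h1 : HasDerivAt (fun t : ℝ => U * (1 - t)) (U * (0 - 1)) t :=
        ((hasDerivAt_const t (1 : ℝ)).sub (hasDerivAt_id t)).const_mul U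
      exact ((hg t ht).add h1).congr_deriv (by ring)
    refine antitoneOn_of_deriv_nonpos (convex_Icc _ _) (fun t ht => (hd t ht).continuousAt.continuousWithinAt)
      (fun t ht => (hd t (interior_subset ht)).differentiableAt.differentiableWithinAt) ?_
    intro t ht
    rw [(hd t (interior_subset ht)).deriv]
    linarith [hU t (interior_subset ht)]
  have hstep : ∀ t ∈ Icc (1 - p) 1, g 1 - U * (1 - t) ≤ g t := by
    intro t ht
    have h1 : (1 : ℝ) ∈ Icc (1 - p) 1 := ⟨by linarith, le_rfl⟩
    have := hφ ht h1 ht.2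
    simp only [sub_self, mul_zero, add_zero] at this
    linarith
  -- Step 2: `ψ(t) = f 1 - f t - (1-t) g 1 + U (1-t)²/2` is nonincreasing, `ψ(1) = 0`
  have hψ : AntitoneOn (fun t => f 1 - f t - (1 - t) * g 1 + U * (1 - t) ^ 2 / 2) (Icc (1 - p) 1) := by
    have hd : ∀ t ∈ Icc (1 - p) 1, HasDerivAt (fun t => f 1 - f t - (1 - t) * g 1 + U * (1 - t) ^ 2 / 2)
        (-g t + g 1 - U * (1 - t)) t := by
      intro t ht
      have h1 : HasDerivAt (fun t : ℝ => (1 - t) * g 1) ((0 - 1) * g 1) t :=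
        ((hasDerivAt_const t (1 : ℝ)).sub (hasDerivAt_id t)).mul_const (g 1)
      have h2 : HasDerivAt (fun t : ℝ => U * (1 - t) ^ 2 / 2) (U * ((2 : ℕ) * (1 - t) ^ (2 - 1) * (0 - 1)) / 2) t :=
        ((((hasDerivAt_const t (1 : ℝ)).sub (hasDerivAt_id t)).pow 2).const_mul U).div_const 2
      exact ((((hasDerivAt_const t (f 1)).sub (hf t ht)).sub h1).add h2).congr_deriv (by push_cast; ring)
    refine antitoneOn_of_deriv_nonpos (convex_Icc _ _) (fun t ht => (hd t ht).continuousAt.continuousWithinAt)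
      (fun t ht => (hd t (interior_subset ht)).differentiableAt.differentiableWithinAt) ?_
    intro t ht
    rw [(hd t (interior_subset ht)).deriv]
    linarith [hstep t (interior_subset ht)]
  have h0 : (1 - p : ℝ) ∈ Icc (1 - p) 1 := ⟨le_rfl, by linarith⟩
  have h1 : (1 : ℝ) ∈ Icc (1 - p) 1 := ⟨by linarith, le_rfl⟩
  have := hψ h0 h1 (by linarith)
  simp only [sub_self, zero_mul, ne_eq, OfNat.ofNat_ne_zero, not_false_eq_true, zero_pow, mul_zero,
    zero_div, add_zero, sub_sub_cancel] at this
  nlinarith [this]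

/-- **Increment ≥ derivative at the right end for a function with nonincreasing derivative**:
if `f' = g` on `[0,1]` and `g` is nonincreasing there, then `g 1 ≤ f 1 - f 0`. [folklore] -/
theorem deriv_right_le_sub {f g : ℝ → ℝ} (hf : ∀ t ∈ Icc (0 : ℝ) 1, HasDerivAt f (g t) t)
    (hg : AntitoneOn g (Icc (0 : ℝ) 1)) : g 1 ≤ f 1 - f 0 := by
  have hφ : MonotoneOn (fun t => f t - t * g 1) (Icc (0 : ℝ) 1) := by
    have hd : ∀ t ∈ Icc (0 : ℝ) 1, HasDerivAt (fun t => f t - t * g 1) (g t - g 1) t := fun t ht =>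
      ((hf t ht).sub ((hasDerivAt_id t).mul_const (g 1))).congr_deriv (by simp)
    refine monotoneOn_of_deriv_nonneg (convex_Icc _ _) (fun t ht => (hd t ht).continuousAt.continuousWithinAt)
      (fun t ht => (hd t (interior_subset ht)).differentiableAt.differentiableWithinAt) ?_
    intro t ht
    rw [(hd t (interior_subset ht)).deriv]
    have ht' := interior_subset ht
    linarith [hg ht' ⟨zero_le_one, le_rfl⟩ ht'.2]
  have := hφ ⟨le_rfl, zero_le_one⟩ ⟨zero_le_one, le_rfl⟩ zero_le_one
  simp only [zero_mul, sub_zero, one_mul] at this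
  linarith

/-! ## Part B. Coupling paths with general interaction terms: derivatives and the Taylor bound -/

section GKS

variable {Λ : Type*} [Fintype Λ] [DecidableEq Λ] {ι : Type*} [DecidableEq ι]
variable (s : Finset ι) (K : ι → ℝ) (C : ι → Finset Λ) (B : Finset ι)

omit [Fintype Λ] [DecidableEq Λ] in
/-- `H_B = ∑_{i ∈ B} Kᵢ σ_{Cᵢ}` for any set of terms `B ⊆ s`. [folklore] -/
theorem gksHamiltonian_cplOn_eq_spinProduct (hBs : B ⊆ s) (ω : SpinConfig Λ) :
    gksHamiltonian s (cplOn K B) C ω = ∑ i ∈ B, K i * spinProduct (C i) ω := by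
  simp only [gksHamiltonian, cplOn, ite_mul, zero_mul]
  rw [Finset.sum_ite_mem, Finset.inter_eq_right.2 hBs]

/-- `Z⟨F H_B⟩ = ∑_{i ∈ B} Kᵢ Z⟨F σ_{Cᵢ}⟩`. [folklore] -/
theorem gksSum_mul_cplOn_spinProduct (hBs : B ⊆ s) (K' : ι → ℝ) (F : SpinConfig Λ → ℝ) :
    gksSum s K' C (fun ω => F ω * gksHamiltonian s (cplOn K B) C ω) =
      ∑ i ∈ B, K i * gksSum s K' C (fun ω => F ω * spinProduct (C i) ω) := by
  simp only [gksSum, gksHamiltonian_cplOn_eq_spinProduct s K C B hBs, Finset.mul_sum, Finset.sum_mul]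
  rw [Finset.sum_comm]
  exact Finset.sum_congr rfl fun i _ => Finset.sum_congr rfl fun ω _ => by ring

/-- **The derivative in the couplings of a set of terms is a sum of truncated correlations**:
`d/dt ⟨F⟩_t = ∑_{i ∈ B} Kᵢ (⟨F σ_{Cᵢ}⟩_t - ⟨F⟩_t ⟨σ_{Cᵢ}⟩_t)` along `cplAt K B t`, for interaction
terms of arbitrary support (Glimm–Jaffe 1987, Prop. 4.2.1). [cite: GlimmJaffe1987, §4.2, Prop. 4.2.1] -/
theorem hasDerivAt_gksExpect_cplAt_cov_spinProduct (hBs : B ⊆ s) (F : SpinConfig Λ → ℝ) (t : ℝ) :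
    HasDerivAt (fun t => gksExpect s (cplAt K B t) C F)
      (∑ i ∈ B, K i * (gksExpect s (cplAt K B t) C (fun ω => F ω * spinProduct (C i) ω) -
        gksExpect s (cplAt K B t) C F * gksExpect s (cplAt K B t) C (spinProduct (C i)))) t := by
  have h := hasDerivAt_gksExpect_cplAt s K C B F t
  have hZ := gksSum_one_pos s (cplAt K B t) C
  set Z := gksSum s (cplAt K B t) C (fun _ => 1) with hZdef
  refine h.congr_deriv ?_
  rw [gksSum_mul_cplOn_spinProduct s K C B hBs, gksSum_mul_cplOn_spinProduct s K C B hBs]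
  simp only [gksExpect, ← hZdef, one_mul]
  have hpt : ∀ i ∈ B, K i * (gksSum s (cplAt K B t) C (fun ω => F ω * spinProduct (C i) ω) / Z -
      gksSum s (cplAt K B t) C F / Z * (gksSum s (cplAt K B t) C (spinProduct (C i)) / Z)) =
      (K i * (gksSum s (cplAt K B t) C (fun ω => F ω * spinProduct (C i) ω) * Z) -
        gksSum s (cplAt K B t) C F * (K i * gksSum s (cplAt K B t) C (spinProduct (C i)))) / Z ^ 2 := by
    intro i _
    field_simp
  rw [Finset.sum_congr rfl hpt, ← Finset.sum_div]
  congr 1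
  rw [Finset.sum_mul, Finset.mul_sum, ← Finset.sum_sub_distrib]
  exact Finset.sum_congr rfl fun i _ => by ring

/-- **The third cumulant** `κ₃(F; P; Q) = ⟨FPQ⟩ - ⟨FP⟩⟨Q⟩ - ⟨FQ⟩⟨P⟩ - ⟨F⟩⟨PQ⟩ + 2⟨F⟩⟨P⟩⟨Q⟩`
of three observables in the state `⟨·⟩_{K'}` (Aizenman–Fernández's `⟨σ_x; σ_yσ_z; σ_kσ_l⟩` for
`F = σ_x`, `P = σ_yσ_z`, `Q = σ_kσ_l`). [cite: AizenmanFernandezJSP1986, §3.4, Cor. 3.7, eq. (3.19), and §5.1, Prop. 5.2] -/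
def gksK3 (K' : ι → ℝ) (F P Q : SpinConfig Λ → ℝ) : ℝ :=
  gksExpect s K' C (fun ω => F ω * P ω * Q ω) - gksExpect s K' C (fun ω => F ω * P ω) * gksExpect s K' C Q -
    gksExpect s K' C (fun ω => F ω * Q ω) * gksExpect s K' C P -
    gksExpect s K' C F * gksExpect s K' C (fun ω => P ω * Q ω) +
    2 * (gksExpect s K' C F * gksExpect s K' C P * gksExpect s K' C Q)

/-- **The derivative of a truncated correlation along a coupling path is a sum of third
cumulants**: `d/dt ⟨F; σ_{Cᵢ}⟩_t = ∑_{j ∈ B} Kⱼ κ₃^t(F; σ_{Cᵢ}; σ_{Cⱼ})` (Aizenman–Fernández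
1986, (5.40)). [cite: AizenmanFernandezJSP1986, §5.2, eq. (5.40), p. 437] [cite: GlimmJaffe1987, §4.2, Prop. 4.2.1] -/
theorem hasDerivAt_gksTrunc_cplAt_spinProduct (hBs : B ⊆ s) (F P : SpinConfig Λ → ℝ) (t : ℝ) :
    HasDerivAt (fun t => gksExpect s (cplAt K B t) C (fun ω => F ω * P ω) -
        gksExpect s (cplAt K B t) C F * gksExpect s (cplAt K B t) C P)
      (∑ j ∈ B, K j * gksK3 s C (cplAt K B t) F P (spinProduct (C j))) t := by
  have h1 := hasDerivAt_gksExpect_cplAt_cov_spinProduct s K C B hBs (fun ω => F ω * P ω) t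
  have h2 := hasDerivAt_gksExpect_cplAt_cov_spinProduct s K C B hBs F t
  have h3 := hasDerivAt_gksExpect_cplAt_cov_spinProduct s K C B hBs P t
  refine (h1.sub (h2.mul h3)).congr_deriv ?_
  rw [Finset.sum_mul, Finset.mul_sum, ← Finset.sum_add_distrib, ← Finset.sum_sub_distrib]
  refine Finset.sum_congr rfl fun j _ => ?_
  simp only [gksK3]
  ring

omit [DecidableEq ι] in
/-- **The diagonal third cumulant has a sign** (Aizenman–Fernández 1986, (5.5)): for an observable
`P` with `P² = 1` (a spin product), `κ₃(F; P; P) = -2 ⟨P⟩ ⟨F; P⟩`. [cite: AizenmanFernandezJSP1986, §5.1, Prop. 5.2, eq. (5.5), p. 426] -/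
theorem gksK3_diag (K' : ι → ℝ) (F : SpinConfig Λ → ℝ) {P : SpinConfig Λ → ℝ} (hP : ∀ ω, P ω * P ω = 1) :
    gksK3 s C K' F P P = -2 * gksExpect s K' C P * (gksExpect s K' C (fun ω => F ω * P ω) - gksExpect s K' C F * gksExpect s K' C P) := by
  simp only [gksK3]
  have h1 : (fun ω => F ω * P ω * P ω) = F := funext fun ω => by rw [mul_assoc, hP, mul_one]
  have h2 : (fun ω => P ω * P ω) = fun _ => (1 : ℝ) := funext fun ω => hP ω
  rw [h1, h2, gksExpect_one]
  ring

omit [DecidableEq ι] in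
/-- **GKS II for the truncated correlation of two spin products**: `⟨σ_y; σ_{Cᵢ}⟩ ≥ 0`. [cite: FriedliVelenik2017, Thm. 3.49, eq. (3.56)] -/
theorem gksTrunc_spinAt_spinProduct_nonneg {K' : ι → ℝ} (hK : ∀ i ∈ s, 0 ≤ K' i) (y : Λ) (A : Finset Λ) :
    0 ≤ gksExpect s K' C (fun ω => spinAt y ω * spinProduct A ω) - gksExpect s K' C (spinAt y) * gksExpect s K' C (spinProduct A) := by
  have h := gksExpect_mul_gksExpect_le s K' C hK {y} A
  have e2 : (spinAt y : SpinConfig Λ → ℝ) = spinProduct {y} := (spinProduct_singleton y).symm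
  have e1 : (fun ω => spinAt y ω * spinProduct A ω) = spinProduct ({y} ∆ A) := by
    funext ω; rw [e2, spinProduct_mul_spinProduct]
  rw [e1, e2]
  linarith

/-- **The second-order lower bound along a coupling path** (the content of Aizenman–Fernández
1986, (5.38)–(5.43), with scaling in place of dilution): for `Kᵢ ≥ 0`, `B ⊆ s` a set of terms,
`Y` a set of sites and `0 ≤ p ≤ 1`, if the off-diagonal third cumulants are bounded along the
path, `∑_{y∈Y} κ₃^t(σ_y; σ_{Cᵢ}; σ_{Cⱼ}) ≤ Ξᵢⱼ` for `t ∈ [1-p, 1]` and `i ≠ j ∈ B`, then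
`p ∑_{i∈B} Kᵢ ∑_{y∈Y} ⟨σ_y; σ_{Cᵢ}⟩_K - (p²/2) ∑_{i∈B} ∑_{j∈B∖{i}} KᵢKⱼ Ξᵢⱼ ≤ ∑_{y∈Y} (⟨σ_y⟩_K - ⟨σ_y⟩_{K_{1-p}})`
(Taylor, `sub_ge_of_deriv2_le`; the diagonal terms `Kᵢ² κ₃(σ_y;σ_{Cᵢ};σ_{Cᵢ}) = -2Kᵢ²⟨σ_{Cᵢ}⟩⟨σ_y;σ_{Cᵢ}⟩`
are `≤ 0` by (5.5) and GKS). [cite: AizenmanFernandezJSP1986, §5.2, eqs. (5.38)–(5.43), pp. 437–438] -/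
theorem gks_scaling_taylor (hK : ∀ i ∈ s, 0 ≤ K i) (hBs : B ⊆ s) (Y : Finset Λ) (Ξ : ι → ι → ℝ)
    {p : ℝ} (hp0 : 0 ≤ p) (hp1 : p ≤ 1)
    (hΞ : ∀ t ∈ Icc (1 - p) 1, ∀ i ∈ B, ∀ j ∈ B, i ≠ j →
      ∑ y ∈ Y, gksK3 s C (cplAt K B t) (spinAt y) (spinProduct (C i)) (spinProduct (C j)) ≤ Ξ i j) :
    p * ∑ i ∈ B, K i * ∑ y ∈ Y, (gksExpect s K C (fun ω => spinAt y ω * spinProduct (C i) ω) -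
          gksExpect s K C (spinAt y) * gksExpect s K C (spinProduct (C i))) -
        p ^ 2 / 2 * ∑ i ∈ B, ∑ j ∈ B.erase i, K i * K j * Ξ i j ≤
      ∑ y ∈ Y, (gksExpect s K C (spinAt y) - gksExpect s (cplAt K B (1 - p)) C (spinAt y)) := by
  -- the path, its derivative and second derivative
  set f : ℝ → ℝ := fun t => ∑ y ∈ Y, gksExpect s (cplAt K B t) C (spinAt y) with hf
  set g : ℝ → ℝ := fun t => ∑ y ∈ Y, ∑ i ∈ B, K i *
    (gksExpect s (cplAt K B t) C (fun ω => spinAt y ω * spinProduct (C i) ω) -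
      gksExpect s (cplAt K B t) C (spinAt y) * gksExpect s (cplAt K B t) C (spinProduct (C i))) with hg
  set g' : ℝ → ℝ := fun t => ∑ y ∈ Y, ∑ i ∈ B, K i * ∑ j ∈ B, K j *
    gksK3 s C (cplAt K B t) (spinAt y) (spinProduct (C i)) (spinProduct (C j)) with hg'
  have hfd : ∀ t, HasDerivAt f (g t) t := fun t =>
    HasDerivAt.fun_sum fun y _ => hasDerivAt_gksExpect_cplAt_cov_spinProduct s K C B hBs (spinAt y) t
  have hgd : ∀ t, HasDerivAt g (g' t) t := fun t =>
    HasDerivAt.fun_sum fun y _ => HasDerivAt.fun_sum fun i _ =>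
      (hasDerivAt_gksTrunc_cplAt_spinProduct s K C B hBs (spinAt y) (spinProduct (C i)) t).const_mul (K i)
  -- the bound on the second derivative
  set U : ℝ := ∑ i ∈ B, ∑ j ∈ B.erase i, K i * K j * Ξ i j with hU
  have hU' : ∀ t ∈ Icc (1 - p) 1, g' t ≤ U := by
    intro t ht
    have ht0 : 0 ≤ t := by linarith [ht.1]
    have hKt : ∀ i ∈ s, 0 ≤ cplAt K B t i := cplAt_nonneg s K B hK ht0
    -- exchange the sums over `y` and `i, j`
    have hswap : g' t = ∑ i ∈ B, ∑ j ∈ B, K i * K j *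
        ∑ y ∈ Y, gksK3 s C (cplAt K B t) (spinAt y) (spinProduct (C i)) (spinProduct (C j)) := by
      simp only [hg']
      rw [Finset.sum_comm]
      refine Finset.sum_congr rfl fun i _ => ?_
      simp only [Finset.mul_sum]
      rw [Finset.sum_comm]
      exact Finset.sum_congr rfl fun j _ => Finset.sum_congr rfl fun y _ => by ring
    rw [hswap, hU]
    refine Finset.sum_le_sum fun i hi => ?_
    rw [← Finset.add_sum_erase B _ hi]
    -- diagonal term `≤ 0`
    have hdiag : K i * K i * ∑ y ∈ Y, gksK3 s C (cplAt K B t) (spinAt y) (spinProduct (C i)) (spinProduct (C i)) ≤ 0 := by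
      refine mul_nonpos_of_nonneg_of_nonpos (mul_nonneg (hK i (hBs hi)) (hK i (hBs hi))) ?_
      refine Finset.sum_nonpos fun y _ => ?_
      rw [gksK3_diag s C (cplAt K B t) (spinAt y) (spinProduct_mul_self (C i))]
      have h1 : 0 ≤ gksExpect s (cplAt K B t) C (spinProduct (C i)) := gksExpect_spinProduct_nonneg s _ C hKt _
      have h2 := gksTrunc_spinAt_spinProduct_nonneg s C hKt y (C i)
      nlinarith
    -- off-diagonal terms
    have hoff : ∑ j ∈ B.erase i, K i * K j *
        ∑ y ∈ Y, gksK3 s C (cplAt K B t) (spinAt y) (spinProduct (C i)) (spinProduct (C j)) ≤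
        ∑ j ∈ B.erase i, K i * K j * Ξ i j := by
      refine Finset.sum_le_sum fun j hj => ?_
      obtain ⟨hji, hjB⟩ := Finset.mem_erase.1 hj
      exact mul_le_mul_of_nonneg_left (hΞ t ht i hi j hjB (Ne.symm hji)) (mul_nonneg (hK i (hBs hi)) (hK j (hBs hjB)))
    linarith
  -- Taylor
  have hT := sub_ge_of_deriv2_le (f := f) (g := g) (g' := g') (U := U) hp0 (fun t _ => hfd t) (fun t _ => hgd t) hU'
  -- identify the endpoints
  have hg1 : g 1 = ∑ i ∈ B, K i * ∑ y ∈ Y, (gksExpect s K C (fun ω => spinAt y ω * spinProduct (C i) ω) -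
      gksExpect s K C (spinAt y) * gksExpect s K C (spinProduct (C i))) := by
    simp only [hg, cplAt_one]
    rw [Finset.sum_comm]
    exact Finset.sum_congr rfl fun i _ => by rw [Finset.mul_sum]
  have hf1 : f 1 - f (1 - p) = ∑ y ∈ Y, (gksExpect s K C (spinAt y) - gksExpect s (cplAt K B (1 - p)) C (spinAt y)) := by
    simp only [hf, cplAt_one]
    rw [← Finset.sum_sub_distrib]
  rw [hg1] at hT
  rw [← hf1]
  linarith

/-! ## Part C. The weak GHS inequality -/

variable (pt : ι → Λ)

/-- **The increment of the magnetisation along a field path dominates the derivative at the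
end**: for `Kᵢ ≥ 0` on supports of at most two sites and `B` a set of one-body terms,
`∑_{i∈B} Kᵢ ⟨σ_a; σ_{pᵢ}⟩_K ≤ ⟨σ_a⟩_K - ⟨σ_a⟩_{K off B}` (the derivative
`t ↦ ∑ Kᵢ⟨σ_a;σ_{pᵢ}⟩_t` is nonincreasing by GHS, `antitoneOn_gksTrunc_cplAt`). [cite: Lebowitz1974, §2, Remark (ii) following the proof of the Theorem] -/
theorem gks_sum_field_cov_le_sub (hK : ∀ i ∈ s, 0 ≤ K i) (hC : ∀ i ∈ s, (C i).card ≤ 2)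
    (hBs : B ⊆ s) (hB : ∀ i ∈ B, C i = {pt i}) (a : Λ) :
    ∑ i ∈ B, K i * (gksExpect s K C (fun ω => spinAt a ω * spinAt (pt i) ω) -
        gksExpect s K C (spinAt a) * gksExpect s K C (spinAt (pt i))) ≤
      gksExpect s K C (spinAt a) - gksExpect s (cplOff K B) C (spinAt a) := by
  set f : ℝ → ℝ := fun t => gksExpect s (cplAt K B t) C (spinAt a) with hf
  set g : ℝ → ℝ := fun t => ∑ i ∈ B, K i * (gksExpect s (cplAt K B t) C (fun ω => spinAt a ω * spinAt (pt i) ω) -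
    gksExpect s (cplAt K B t) C (spinAt a) * gksExpect s (cplAt K B t) C (spinAt (pt i))) with hg
  have hfd : ∀ t, HasDerivAt f (g t) t := fun t => hasDerivAt_gksExpect_cplAt_cov_single s K C B pt hBs hB (spinAt a) t
  have hga : AntitoneOn g (Icc (0 : ℝ) 1) := by
    intro t₁ ht₁ t₂ ht₂ h12
    simp only [hg]
    refine Finset.sum_le_sum fun i hi => mul_le_mul_of_nonneg_left ?_ (hK i (hBs hi))
    exact antitoneOn_gksTrunc_cplAt s K C B pt hK hC hBs hB a (pt i) (mem_Ici.2 ht₁.1) (mem_Ici.2 ht₂.1) h12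
  have h := deriv_right_le_sub (fun t _ => hfd t) hga
  simp only [hf, hg, cplAt_one, cplAt_zero] at h
  exact h

/-- **The weak GHS inequality** `∑_{i ∈ B} Kᵢ ⟨σ_a; σ_{pᵢ}⟩ ≤ ⟨σ_a⟩`: if moreover switching off
the one-body terms `B` leaves a system with even interaction terms only (zero field), then
`⟨σ_a⟩_{K off B} = 0` (spin flip) and the increment is `⟨σ_a⟩_K` itself. This is the
finite-volume, general-coupling form of `βh · χ ≤ M` (GHS concavity of the magnetisation in
the field; Aizenman–Fernández 1986, the rightmost inequality of (4.26) summed over `y`). [cite: AizenmanFernandezJSP1986, §4.3, eq. (4.26)] [cite: Lebowitz1974, §2, Remark (ii) following the proof of the Theorem] -/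
theorem gks_sum_field_cov_le (hK : ∀ i ∈ s, 0 ≤ K i) (hC : ∀ i ∈ s, (C i).card ≤ 2)
    (hBs : B ⊆ s) (hB : ∀ i ∈ B, C i = {pt i}) (heven : ∀ i ∈ s, cplOff K B i = 0 ∨ Even (C i).card) (a : Λ) :
    ∑ i ∈ B, K i * (gksExpect s K C (fun ω => spinAt a ω * spinAt (pt i) ω) -
        gksExpect s K C (spinAt a) * gksExpect s K C (spinAt (pt i))) ≤ gksExpect s K C (spinAt a) := by
  have h := gks_sum_field_cov_le_sub s K C B pt hK hC hBs hB a
  have h0 : gksExpect s (cplOff K B) C (spinAt a) = 0 := by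
    rw [gksExpect, gksSum_spinAt_eq_zero_of_even s C (cplOff K B) a heven, zero_div]
  linarith

end GKS

/-! ## Part D. The `θ`-system on `Λ ∪ {g}` -/

section Theta

variable {V : Type*} [DecidableEq V] {G : SimpleGraph V} [G.LocallyFinite] {Λ : Finset V}

/-- Sums over the sites of `Y ⊆ Λ` in subtype form. [folklore] -/
theorem sum_inVol_eq {Y : Finset V} (hY : Y ⊆ Λ) (ψ : V → ℝ) :
    ∑ z ∈ inVol Λ Y, ψ z = ∑ y ∈ Y, ψ y := by
  refine Finset.sum_bij (fun z _ => (z : V)) (fun z hz => (Finset.mem_filter.1 hz).2)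
    (fun z₁ _ z₂ _ h => Subtype.ext h) (fun y hy => ⟨⟨y, hY hy⟩, Finset.mem_filter.2 ⟨Finset.mem_univ _, hy⟩, rfl⟩)
    (fun _ _ => rfl)

/-- The sites of `Λ` as one-body indices. [folklore] -/
def siteIdx (Λ : Finset V) : Finset (Sym2 V ⊕ V) := Λ.map ⟨Sum.inr, Sum.inr_injective⟩

omit [DecidableEq V] in
/-- Membership in `siteIdx`. [folklore] -/
theorem mem_siteIdx_iff {i : Sym2 V ⊕ V} : i ∈ siteIdx Λ ↔ ∃ x ∈ Λ, i = Sum.inr x := by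
  unfold siteIdx; rw [Finset.mem_map]
  exact ⟨fun ⟨x, hx, h⟩ => ⟨x, hx, h.symm⟩, fun ⟨x, hx, h⟩ => ⟨x, hx, h.symm⟩⟩

/-- `siteIdx Λ ⊆ isingIdx G Λ`. [folklore] -/
theorem siteIdx_subset : siteIdx Λ ⊆ isingIdx G Λ := by
  intro i hi
  obtain ⟨x, hx, rfl⟩ := mem_siteIdx_iff.1 hi
  unfold isingIdx; exact Finset.inr_mem_disjSum.2 hx

/-- The lattice edges of `D ⊆ ℰ_Λ` as pair indices. [folklore] -/
def bondIdx (D : Finset (Sym2 V)) : Finset (Sym2 V ⊕ V) := D.map ⟨Sum.inl, Sum.inl_injective⟩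

omit [DecidableEq V] in
/-- Membership in `bondIdx`. [folklore] -/
theorem mem_bondIdx_iff {D : Finset (Sym2 V)} {i : Sym2 V ⊕ V} : i ∈ bondIdx D ↔ ∃ e ∈ D, i = Sum.inl e := by
  unfold bondIdx; rw [Finset.mem_map]
  exact ⟨fun ⟨x, hx, h⟩ => ⟨x, hx, h.symm⟩, fun ⟨x, hx, h⟩ => ⟨x, hx, h.symm⟩⟩

/-- `bondIdx D ⊆ isingIdx G Λ` for `D ⊆ ℰ_Λ`. [folklore] -/
theorem bondIdx_subset {D : Finset (Sym2 V)} (hD : D ⊆ edgesIn G Λ) : bondIdx D ⊆ isingIdx G Λ := by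
  intro i hi
  obtain ⟨e, he, rfl⟩ := mem_bondIdx_iff.1 hi
  unfold isingIdx; exact Finset.inl_mem_disjSum.2 (edgesIn_subset_edgesTouching Λ (hD he))

/-- The support of an edge inside `Λ` has two sites. [folklore] -/
theorem card_isingSupp_inl_of_mem_edgesIn {e : Sym2 V} (he : e ∈ edgesIn G Λ) : (isingSupp Λ (.inl e)).card = 2 := by
  obtain ⟨hadj, hmem⟩ := mem_edgesIn_iff.1 he
  induction e using Sym2.ind with
  | _ x y =>
    have hxy : x ≠ y := G.ne_of_adj ((SimpleGraph.mem_edgeSet G).1 hadj)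
    have hx : x ∈ Λ := hmem x (Sym2.mem_mk_left x y)
    have hy : y ∈ Λ := hmem y (Sym2.mem_mk_right x y)
    have hset : isingSupp Λ (.inl s(x, y)) = {⟨x, hx⟩, ⟨y, hy⟩} := by
      ext z
      simp only [isingSupp, Finset.mem_filter, Finset.mem_univ, true_and, Sym2.mem_iff, Finset.mem_insert,
        Finset.mem_singleton]
      constructor
      · rintro (h | h)
        · exact Or.inl (Subtype.ext h)
        · exact Or.inr (Subtype.ext h)
      · rintro (h | h)
        · exact Or.inl (congrArg Subtype.val h)
        · exact Or.inr (congrArg Subtype.val h)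
    rw [hset, Finset.card_pair fun h => hxy (congrArg Subtype.val h)]

/-- **The couplings scaled on a set of lattice bonds**, read on the `gksExpect` side:
`thetaCpl (θ scaled by t on D) = cplAt (thetaCpl θ) (bondIdx D) t` for `D ⊆ ℰ_Λ`. [cite: AizenmanFernandezJSP1986, §5.2, eq. (5.38) ("the coupling constant for each {u,v} … has been multiplied by s")] -/
theorem thetaCpl_cplAt {θ : Sym2 (Option V) → ℝ} {D : Finset (Sym2 V)} (hD : D ⊆ edgesIn G Λ) (t : ℝ) :
    thetaCpl G Λ (cplAt θ (D.map liftEdge) t) = cplAt (thetaCpl G Λ θ) (bondIdx D) t := by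
  funext i
  rcases i with e | x
  · have hmem : (Sum.inl e : Sym2 V ⊕ V) ∈ bondIdx D ↔ e ∈ D := by
      rw [mem_bondIdx_iff]
      exact ⟨fun ⟨e', he', h⟩ => by cases h; exact he', fun h => ⟨e, h, rfl⟩⟩
    have hlift : liftEdge e ∈ D.map liftEdge ↔ e ∈ D := Finset.mem_map' liftEdge
    simp only [thetaCpl, cplAt, hmem, hlift]
    by_cases heD : e ∈ D
    · rw [if_pos heD, if_pos heD, if_pos (hD heD), if_pos (hD heD)]
    · rw [if_neg heD, if_neg heD]
  · have hmem : (Sum.inr x : Sym2 V ⊕ V) ∉ bondIdx D := fun h => by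
      obtain ⟨e, -, he⟩ := mem_bondIdx_iff.1 h; cases he
    have hlift : ghostEdge x ∉ D.map liftEdge := fun h => by
      obtain ⟨e, -, he⟩ := Finset.mem_map.1 h
      exact liftEdge_ne_ghostEdge e x he
    simp only [thetaCpl, cplAt, hmem, hlift, if_false]

variable (G Λ) in
/-- **The third cumulant in the `θ`-state**, `κ₃^θ(F;P;Q)`. [cite: AizenmanFernandezJSP1986, §3.4, Cor. 3.7, eq. (3.19)] -/
def thetaK3 (θ : Sym2 (Option V) → ℝ) (F P Q : SpinConfig V → ℝ) : ℝ :=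
  thetaExpect G Λ θ (fun σ => F σ * P σ * Q σ) - thetaExpect G Λ θ (fun σ => F σ * P σ) * thetaExpect G Λ θ Q -
    thetaExpect G Λ θ (fun σ => F σ * Q σ) * thetaExpect G Λ θ P -
    thetaExpect G Λ θ F * thetaExpect G Λ θ (fun σ => P σ * Q σ) +
    2 * (thetaExpect G Λ θ F * thetaExpect G Λ θ P * thetaExpect G Λ θ Q)

/-- `κ₃^θ` is `gksK3` of the glued observables. [folklore] -/
theorem thetaK3_eq_gksK3 (θ : Sym2 (Option V) → ℝ) (F P Q : SpinConfig V → ℝ) :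
    thetaK3 G Λ θ F P Q = gksK3 (isingIdx G Λ) (isingSupp Λ) (thetaCpl G Λ θ)
      (fun τ => F (glue Λ τ .free)) (fun τ => P (glue Λ τ .free)) (fun τ => Q (glue Λ τ .free)) := rfl

/-- The bond spin of an edge inside `Λ` is the spin product of its support, in glued form. [folklore] -/
theorem spinProduct_isingSupp_inl_eq_bondSpin {e : Sym2 V} (he : e ∈ edgesIn G Λ) (τ : SpinConfig ↥Λ) :
    spinProduct (isingSupp Λ (.inl e)) τ = bondSpin (glue Λ τ .free) e := by
  obtain ⟨hadj, hmem⟩ := mem_edgesIn_iff.1 he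
  induction e using Sym2.ind with
  | _ x y =>
    have hxy : x ≠ y := G.ne_of_adj ((SimpleGraph.mem_edgeSet G).1 hadj)
    rw [spinProduct_isingSupp_inl τ .free hxy, if_pos (hmem x (Sym2.mem_mk_left x y)),
      if_pos (hmem y (Sym2.mem_mk_right x y)), bondSpin_mk]

/-- **Aizenman–Fernández's second-order dilution bound, scaling form, for the `θ`-system**: for
`θ ≥ 0`, `D ⊆ ℰ_Λ` a set of lattice bonds, `Y ⊆ Λ`, `0 ≤ p ≤ 1`, and a bound `Ξ` on the
off-diagonal summed third cumulants `∑_{y∈Y} κ₃^{θ_t}(σ_y; σ_e; σ_{e'}) ≤ Ξ(e,e')` along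
`θ_t = θ` scaled by `t ∈ [1-p,1]` on `D`,
`p ∑_{e∈D} θ_e ∑_{y∈Y} ⟨σ_y;σ_e⟩_θ - (p²/2) ∑_{e∈D}∑_{e'∈D∖{e}} θ_eθ_{e'} Ξ(e,e') ≤ ∑_{y∈Y} (⟨σ_y⟩_θ - ⟨σ_y⟩_{θ_{1-p}})`. [cite: AizenmanFernandezJSP1986, §5.2, eqs. (5.37)–(5.43), pp. 437–438] -/
theorem theta_scaling_taylor {θ : Sym2 (Option V) → ℝ} (hθ : ∀ e, 0 ≤ θ e) {D : Finset (Sym2 V)}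
    (hD : D ⊆ edgesIn G Λ) {Y : Finset V} (hY : Y ⊆ Λ) (Ξ : Sym2 V → Sym2 V → ℝ) {p : ℝ} (hp0 : 0 ≤ p) (hp1 : p ≤ 1)
    (hΞ : ∀ t ∈ Icc (1 - p) 1, ∀ e ∈ D, ∀ e' ∈ D, e ≠ e' →
      ∑ y ∈ Y, thetaK3 G Λ (cplAt θ (D.map liftEdge) t) (spinAt y) (fun σ => bondSpin σ e) (fun σ => bondSpin σ e') ≤ Ξ e e') :
    p * ∑ e ∈ D, θ (liftEdge e) * ∑ y ∈ Y, (thetaExpect G Λ θ (fun σ => spinAt y σ * bondSpin σ e) -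
          thetaCorr G Λ θ {y} * thetaExpect G Λ θ (fun σ => bondSpin σ e)) -
        p ^ 2 / 2 * ∑ e ∈ D, ∑ e' ∈ D.erase e, θ (liftEdge e) * θ (liftEdge e') * Ξ e e' ≤
      ∑ y ∈ Y, (thetaCorr G Λ θ {y} - thetaCorr G Λ (cplAt θ (D.map liftEdge) (1 - p)) {y}) := by
  classical
  set sI := isingIdx G Λ with hsI
  set K := thetaCpl G Λ θ with hK
  set Cs := isingSupp Λ with hCs
  set B := bondIdx D with hB
  have hKnn : ∀ i ∈ sI, 0 ≤ K i := thetaCpl_nonneg hθ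
  have hBs : B ⊆ sI := bondIdx_subset hD
  -- the bound function on indices
  set ΞI : (Sym2 V ⊕ V) → (Sym2 V ⊕ V) → ℝ := fun i j =>
    match i, j with
    | .inl e, .inl e' => Ξ e e'
    | _, _ => 0 with hΞI
  have hmain := gks_scaling_taylor sI K Cs B hKnn hBs (inVol Λ Y) ΞI hp0 hp1 ?_
  · -- translate the conclusion
    have hpath : ∀ t, cplAt K B t = thetaCpl G Λ (cplAt θ (D.map liftEdge) t) := fun t => (thetaCpl_cplAt hD t).symm
    -- first-order term
    have hsumB : ∀ (φ : Sym2 V ⊕ V → ℝ), ∑ i ∈ B, φ i = ∑ e ∈ D, φ (.inl e) := fun φ => by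
      simp only [hB, bondIdx, Finset.sum_map, Function.Embedding.coeFn_mk]
    have hsumBe : ∀ (e : Sym2 V) (φ : Sym2 V ⊕ V → ℝ), ∑ j ∈ B.erase (.inl e), φ j = ∑ e' ∈ D.erase e, φ (.inl e') := by
      intro e φ
      have : B.erase (.inl e) = (D.erase e).map ⟨Sum.inl, Sum.inl_injective⟩ := by
        simp only [hB, bondIdx]
        exact (Finset.map_erase ⟨Sum.inl, Sum.inl_injective⟩ D e).symm
      rw [this, Finset.sum_map]
      rfl
    have hfirst : ∑ i ∈ B, K i * ∑ y ∈ inVol Λ Y, (gksExpect sI K Cs (fun ω => spinAt y ω * spinProduct (Cs i) ω) -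
          gksExpect sI K Cs (spinAt y) * gksExpect sI K Cs (spinProduct (Cs i))) =
        ∑ e ∈ D, θ (liftEdge e) * ∑ y ∈ Y, (thetaExpect G Λ θ (fun σ => spinAt y σ * bondSpin σ e) -
          thetaCorr G Λ θ {y} * thetaExpect G Λ θ (fun σ => bondSpin σ e)) := by
      rw [hsumB]
      refine Finset.sum_congr rfl fun e he => ?_
      have hKe : K (.inl e) = θ (liftEdge e) := by simp only [hK, thetaCpl, if_pos (hD he)]
      rw [hKe]
      congr 1
      refine (Finset.sum_congr rfl fun z _ => ?_).trans (sum_inVol_eq hY (fun y =>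
        thetaExpect G Λ θ (fun σ => spinAt y σ * bondSpin σ e) - thetaCorr G Λ θ {y} * thetaExpect G Λ θ (fun σ => bondSpin σ e)))
      have hz : (z : V) ∈ Λ := z.2
      rw [thetaCorr_singleton_eq_gksExpect θ hz, Subtype.coe_eta]
      simp only [thetaExpect]
      have e1 : (fun ω => spinAt z ω * spinProduct (Cs (Sum.inl e)) ω) =
          fun τ => spinAt (z : V) (glue Λ τ .free) * bondSpin (glue Λ τ .free) e := by
        funext τ
        rw [hCs, spinProduct_isingSupp_inl_eq_bondSpin (hD he), spinAt_glue_of_mem τ .free hz, Subtype.coe_eta]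
      have e2 : (spinProduct (Cs (Sum.inl e)) : SpinConfig ↥Λ → ℝ) = fun τ => bondSpin (glue Λ τ .free) e := by
        funext τ
        rw [hCs, spinProduct_isingSupp_inl_eq_bondSpin (hD he)]
      rw [e1, e2]
    -- second-order term
    have hsecond : ∑ i ∈ B, ∑ j ∈ B.erase i, K i * K j * ΞI i j =
        ∑ e ∈ D, ∑ e' ∈ D.erase e, θ (liftEdge e) * θ (liftEdge e') * Ξ e e' := by
      rw [hsumB]
      refine Finset.sum_congr rfl fun e he => ?_
      rw [hsumBe]
      refine Finset.sum_congr rfl fun e' he' => ?_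
      have hKe : K (.inl e) = θ (liftEdge e) := by simp only [hK, thetaCpl, if_pos (hD he)]
      have hKe' : K (.inl e') = θ (liftEdge e') := by simp only [hK, thetaCpl, if_pos (hD (Finset.mem_erase.1 he').2)]
      rw [hKe, hKe']
    -- zeroth-order term
    have hzero : ∑ y ∈ inVol Λ Y, (gksExpect sI K Cs (spinAt y) - gksExpect sI (cplAt K B (1 - p)) Cs (spinAt y)) =
        ∑ y ∈ Y, (thetaCorr G Λ θ {y} - thetaCorr G Λ (cplAt θ (D.map liftEdge) (1 - p)) {y}) := by
      refine (Finset.sum_congr rfl fun z _ => ?_).trans (sum_inVol_eq hY (fun y =>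
        thetaCorr G Λ θ {y} - thetaCorr G Λ (cplAt θ (D.map liftEdge) (1 - p)) {y}))
      have hz : (z : V) ∈ Λ := z.2
      rw [thetaCorr_singleton_eq_gksExpect θ hz, thetaCorr_singleton_eq_gksExpect _ hz, hpath, Subtype.coe_eta]
    rw [hfirst, hsecond, hzero] at hmain
    exact hmain
  · -- the hypothesis on the third cumulants
    intro t ht i hi j hj hij
    obtain ⟨e, he, rfl⟩ := mem_bondIdx_iff.1 hi
    obtain ⟨e', he', rfl⟩ := mem_bondIdx_iff.1 hj
    have hee' : e ≠ e' := fun h => hij (by rw [h])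
    have h := hΞ t ht e he e' he' hee'
    rw [← sum_inVol_eq hY (fun y => thetaK3 G Λ (cplAt θ (D.map liftEdge) t) (spinAt y)
      (fun σ => bondSpin σ e) (fun σ => bondSpin σ e'))] at h
    refine le_of_eq_of_le ?_ h
    refine Finset.sum_congr rfl fun z _ => ?_
    have hz : (z : V) ∈ Λ := z.2
    rw [thetaK3_eq_gksK3, thetaCpl_cplAt hD t]
    have e0 : (spinAt z : SpinConfig ↥Λ → ℝ) = fun τ => spinAt (z : V) (glue Λ τ .free) := by
      funext τ; rw [spinAt_glue_of_mem τ .free hz, Subtype.coe_eta]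
    have e1 : (spinProduct (Cs (Sum.inl e)) : SpinConfig ↥Λ → ℝ) = fun τ => bondSpin (glue Λ τ .free) e := by
      funext τ; rw [hCs, spinProduct_isingSupp_inl_eq_bondSpin (hD he)]
    have e2 : (spinProduct (Cs (Sum.inl e')) : SpinConfig ↥Λ → ℝ) = fun τ => bondSpin (glue Λ τ .free) e' := by
      funext τ; rw [hCs, spinProduct_isingSupp_inl_eq_bondSpin (hD he')]
    rw [e0, e1, e2]

/-- **The weak GHS inequality for the `θ`-system**: for `θ ≥ 0` and `a ∈ Λ`,
`∑_{z ∈ Λ} θ_{z,g} ⟨σ_a; σ_z⟩_θ ≤ ⟨σ_a⟩_θ` (with the fields `θ_{z,g} ≥ 0` switched off the system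
is at zero field and `⟨σ_a⟩ = 0`; the magnetisation is concave along `t ↦ t·(fields)` by GHS).
For uniform fields `θ_{z,g} = βh` this is `βh ∑_z ⟨σ_a;σ_z⟩ ≤ ⟨σ_a⟩`, the finite-volume form of
the rightmost inequality in Aizenman–Fernández's (4.26). [cite: AizenmanFernandezJSP1986, §4.3, eq. (4.26)] [cite: Lebowitz1974, §2, Remark (ii) following the proof of the Theorem] -/
theorem thetaCorr_sum_field_trunc_le {θ : Sym2 (Option V) → ℝ} (hθ : ∀ e, 0 ≤ θ e) {a : V} (ha : a ∈ Λ) :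
    ∑ z ∈ Λ, θ (ghostEdge z) * (thetaCorr G Λ θ ({a} ∆ {z}) - thetaCorr G Λ θ {a} * thetaCorr G Λ θ {z}) ≤
      thetaCorr G Λ θ {a} := by
  classical
  set sI := isingIdx G Λ with hsI
  set K := thetaCpl G Λ θ with hK
  set Cs := isingSupp Λ with hCs
  set B := siteIdx Λ with hB
  have hKnn : ∀ i ∈ sI, 0 ≤ K i := thetaCpl_nonneg hθ
  have hBs : B ⊆ sI := siteIdx_subset
  have hC2 : ∀ i ∈ sI, (Cs i).card ≤ 2 := fun i _ => card_isingSupp_le_two Λ i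
  -- the site of a one-body index
  set pt : Sym2 V ⊕ V → ↥Λ := fun i =>
    match i with
    | .inr x => if h : x ∈ Λ then ⟨x, h⟩ else ⟨a, ha⟩
    | .inl _ => ⟨a, ha⟩ with hpt
  have hBC : ∀ i ∈ B, Cs i = {pt i} := by
    intro i hi
    obtain ⟨x, hx, rfl⟩ := mem_siteIdx_iff.1 hi
    simp only [hCs, hpt, dif_pos hx]
    exact isingSupp_inr_eq_singleton hx
  have heven : ∀ i ∈ sI, cplOff K B i = 0 ∨ Even (Cs i).card := by
    intro i hi
    rcases i with e | x
    · by_cases he : e ∈ edgesIn G Λ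
      · right
        rw [hCs, card_isingSupp_inl_of_mem_edgesIn he]
        exact even_two
      · left
        have : (Sum.inl e : Sym2 V ⊕ V) ∉ B := fun h => by
          obtain ⟨x, -, hx⟩ := mem_siteIdx_iff.1 h; cases hx
        simp only [cplOff, this, if_false, hK, thetaCpl, he]
    · left
      have hx : x ∈ Λ := by
        simp only [hsI, isingIdx, Finset.inr_mem_disjSum] at hi; exact hi
      have : (Sum.inr x : Sym2 V ⊕ V) ∈ B := mem_siteIdx_iff.2 ⟨x, hx, rfl⟩
      simp only [cplOff, this, if_true]
  have hmain := gks_sum_field_cov_le sI K Cs B pt hKnn hC2 hBs hBC heven ⟨a, ha⟩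
  -- translate
  have hsumB : ∀ (φ : Sym2 V ⊕ V → ℝ), ∑ i ∈ B, φ i = ∑ z ∈ Λ, φ (.inr z) := fun φ => by
    simp only [hB, siteIdx, Finset.sum_map, Function.Embedding.coeFn_mk]
  rw [hsumB] at hmain
  rw [thetaCorr_singleton_eq_gksExpect θ ha]
  refine le_of_eq_of_le ?_ hmain
  refine Finset.sum_congr rfl fun z hz => ?_
  have hKz : K (.inr z) = θ (ghostEdge z) := by simp only [hK, thetaCpl]
  have hpz : pt (.inr z) = ⟨z, hz⟩ := by simp only [hpt, dif_pos hz]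
  rw [hKz, hpz, thetaCorr_pair_eq_gksExpect θ ha hz, thetaCorr_singleton_eq_gksExpect θ hz]

end Theta

end Literature.Probability.LatticeModels
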